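import Mathlib
import Summits.QuantumAdvantage.QuantumAdvantage.Theorems.MobiusLadderLiouvilleOrthogonalTC0StubDilate
import Summits.QuantumAdvantage.QuantumAdvantage.Theorems.MobiusLadderLiouvilleOrthogonalTC0StubDecideLt
import Summits.QuantumAdvantage.QuantumAdvantage.Theorems.MobiusLadderLiouvilleOrthogonalTC0StubSqIdentities
import Literature.Computability.AlgebraicComplexity.BooleanGadgets
import Literature.Computability.Complexity.ThresholdGadgets
import Literature.Probability.RandomGraphs.LowDegree
import HarnessLib

/-!
# Crux `MobiusLadder.LiouvilleOrthogonalTC0` (stmt-QuantumAdvantage-1393), line `Sketch`, v8.1 (Möbius bridge):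
stub `stub_sqTransfer` — `TC⁰`-orthogonality passes along convolution with square divisors

Line `Sketch` (lead `prover-line-stmt-QuantumAdvantage-1393-c5-0`). The engine of the bridge
"`LiouvilleOrthogonalTC0` (for `λ`) ⇔ Kalai's `TC⁰` conjecture (for `μ`)": if a bounded sequence
`g : ℕ → ℤ` is asymptotically orthogonal to every polynomial-size constant-depth `tcBasis` circuit of
the binary digits, then so is `N ↦ Σ_{e² ∣ N} h(e) g(N/e²)` for every bounded `h` (applied with
`(g, h) = (μ, 1)` it gives `λ`, with `(g, h) = (λ, μ)` it gives back `μ`: `stub_lamOfMu`, `stub_muOfLam`).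
Proof: reindex `N = e² m` (`sqTransfer_reindex`); the `e > D₀` tail carries at most `2ⁿ/D₀` terms
(`stub_sqTail`); for each `e ≤ D₀` the truncated sum `Σ_{1 ≤ m ≤ (2ⁿ−1)/e²} g(m) F(e²m)` is half the
sum of the correlations of `g` with the two circuits `C(bits(e²·)) ∧ [· ≤ M]` and `C(bits(e²·)) ∨ [· > M]`
(`stub_dilate`: multiplication by the constant `e²` inside `TC⁰`; `stub_decideLt`: comparison with a
constant in `AC⁰`), each of depth `d + 14` and polynomial size, to which the hypothesis applies.
-/

set_option linter.dupNamespace false -- D-0017: single-problem summit ⇒ `QuantumAdvantage.QuantumAdvantage` by design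

noncomputable section

namespace Summit.QuantumAdvantage.QuantumAdvantage.Theorems.LiouvilleOrthogonalTC0

open Filter Finset
open Literature.Computability.Complexity
open Literature.Probability.RandomGraphs.LowDegree (sgn)

namespace SqTransfer

/-- **Reindexing by square divisors**: for any `φ`,
`Σ_{N<2ⁿ} Σ_{e ∈ divisors N, e² ∣ N} φ e N = Σ_{1 ≤ e ≤ 2ⁿ} Σ_{1 ≤ m ≤ (2ⁿ−1)/e²} φ e (e² m)`. -/
theorem reindex {M : Type*} [AddCommMonoid M] (n : ℕ) (φ : ℕ → ℕ → M) :
    ∑ N ∈ range (2 ^ n), ∑ e ∈ N.divisors.filter (fun e => e * e ∣ N), φ e N =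
      ∑ e ∈ Ioc 0 (2 ^ n), ∑ m ∈ Ioc 0 ((2 ^ n - 1) / (e * e)), φ e (e * e * m) := by
  classical
  -- swap the two summations
  have hswap : ∑ N ∈ range (2 ^ n), ∑ e ∈ N.divisors.filter (fun e => e * e ∣ N), φ e N =
      ∑ e ∈ Ioc 0 (2 ^ n), ∑ N ∈ (range (2 ^ n)).filter (fun N => N ≠ 0 ∧ e * e ∣ N), φ e N := by
    refine Finset.sum_comm' (fun N e => ?_)
    simp only [mem_range, mem_filter, Nat.mem_divisors, mem_Ioc]
    constructor
    · rintro ⟨hN, ⟨hd, hN0⟩, hsq⟩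
      refine ⟨⟨hN, hN0, hsq⟩, Nat.pos_of_ne_zero (fun h => ?_), ?_⟩
      · subst h; simp at hd; exact hN0 hd
      · exact (Nat.le_of_dvd (Nat.pos_of_ne_zero hN0) hd).trans hN.le
    · rintro ⟨⟨hN, hN0, hsq⟩, he, -⟩
      exact ⟨hN, ⟨(Dvd.intro_left _ rfl : e ∣ e * e).trans hsq, hN0⟩, hsq⟩
  rw [hswap]
  refine sum_congr rfl fun e he => ?_
  have he0 : 0 < e := (mem_Ioc.1 he).1
  have hee : 0 < e * e := Nat.mul_pos he0 he0
  -- `N ↦ N / e²` and `m ↦ e² m`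
  refine Finset.sum_nbij' (fun N => N / (e * e)) (fun m => e * e * m) ?_ ?_ ?_ ?_ ?_
  · intro N hN
    simp only [mem_filter, mem_range] at hN
    obtain ⟨hN2, hN0, hdvd⟩ := hN
    rw [mem_Ioc]
    constructor
    · obtain ⟨k, rfl⟩ := hdvd
      rw [Nat.mul_div_cancel_left _ hee]
      exact Nat.pos_of_ne_zero (fun hk => hN0 (by simp [hk]))
    · exact Nat.div_le_div_right (by omega)
  · intro m hm
    rw [mem_Ioc] at hm
    simp only [mem_filter, mem_range]
    refine ⟨?_, ?_, Dvd.intro _ rfl⟩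
    · have h1 : e * e * m ≤ e * e * ((2 ^ n - 1) / (e * e)) := Nat.mul_le_mul_left _ hm.2
      have h2 : e * e * ((2 ^ n - 1) / (e * e)) ≤ 2 ^ n - 1 := Nat.mul_div_le _ _
      have h3 : 0 < 2 ^ n := Nat.two_pow_pos n
      omega
    · exact Nat.mul_ne_zero hee.ne' (by omega)
  · intro N hN
    simp only [mem_filter, mem_range] at hN
    exact Nat.mul_div_cancel' hN.2.2
  · intro m _
    exact Nat.mul_div_cancel_left _ hee
  · intro N hN
    simp only [mem_filter, mem_range] at hN
    rw [Nat.mul_div_cancel' hN.2.2]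

/-- Boolean bookkeeping of the two truncation gadgets: `sgn(a ∧ b) + sgn(a ∨ ¬b)` is `2·sgn a` if
`b` holds and `0` otherwise. -/
theorem sgn_and_add_sgn_or (a b : Bool) :
    sgn (a && b) + sgn (a || !b) = if b = true then 2 * sgn a else 0 := by
  cases a <;> cases b <;> simp [sgn] <;> norm_num

/-- The digits of `N < 2ⁿ`, read back as a number, give `N`. -/
theorem sum_testBit_toNat {n N : ℕ} (hN : N < 2 ^ n) :
    ∑ j : Fin n, (Nat.testBit N j).toNat * 2 ^ (j : ℕ) = N := by
  rw [← Literature.Computability.AlgebraicComplexity.BoolGadgets.ofBits_eq_sum, Nat.ofBits_testBit,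
    Nat.mod_eq_of_lt hN]

/-- **The two truncation gadgets.** Given a circuit `C` over `tcBasis` (`acDepth ≤ d`, `size ≤ s`), a
multiplier `R` and a threshold `M`, there are two circuits `C₁, C₂` over `tcBasis` of `acDepth ≤ d + D + 4`
and size `≤ s + q(n) + (n+1)² + 3` (`D, q` the dilation constants of `stub_dilate`) with
`sgn C₁(bits N) + sgn C₂(bits N) = [N < M]·2·sgn C(bits(N R))` for all `N < 2ⁿ`
(`C₁ = C(bits(R·)) ∧ [· < M]`, `C₂ = C(bits(R·)) ∨ [· ≥ M]`). -/
theorem exists_gadgets {D : ℕ} {q : Polynomial ℕ}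
    (hdil : ∀ (n d s R : ℕ) (g : (Fin n → Bool) → Bool), ACRealOver tcBasis g d s →
      ACRealOver tcBasis (fun x : Fin n → Bool =>
        g (fun i : Fin n => Nat.testBit ((∑ j : Fin n, (x j).toNat * 2 ^ (j : ℕ)) * R) i)) (d + D) (s + q.eval n))
    (hLt : ∀ (n X : ℕ), ACRealOver tcBasis
      (fun x : Fin n → Bool => decide (∑ i : Fin n, (x i).toNat * 2 ^ (i : ℕ) < X)) 3 ((n + 1) ^ 2 + 1))
    {n d s : ℕ} (C : Circuit (Fin n)) (hB : C.IsOver tcBasis) (hd : C.acDepth ≤ d) (hs : C.size ≤ s)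
    (R M : ℕ) :
    ∃ C₁ C₂ : Circuit (Fin n), C₁.IsOver tcBasis ∧ C₂.IsOver tcBasis ∧
      C₁.acDepth ≤ d + D + 4 ∧ C₂.acDepth ≤ d + D + 4 ∧
      C₁.size ≤ s + q.eval n + (n + 1) ^ 2 + 3 ∧ C₂.size ≤ s + q.eval n + (n + 1) ^ 2 + 3 ∧
      ∀ N : ℕ, N < 2 ^ n →
        sgn (C₁.eval fun i : Fin n => Nat.testBit N i) + sgn (C₂.eval fun i : Fin n => Nat.testBit N i) =
          if N < M then 2 * sgn (C.eval fun i : Fin n => Nat.testBit (N * R) i) else 0 := by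
  -- the dilated circuit and the comparison, lifted to the common depth `d + D + 3`
  set F : (Fin n → Bool) → Bool := fun x =>
    C.eval (fun i : Fin n => Nat.testBit ((∑ j : Fin n, (x j).toNat * 2 ^ (j : ℕ)) * R) i) with hFdef
  set L : (Fin n → Bool) → Bool := fun x =>
    decide (∑ i : Fin n, (x i).toNat * 2 ^ (i : ℕ) < M) with hLdef
  have hF : ACRealOver tcBasis F (d + D + 3) (s + q.eval n) :=
    (hdil n d s R C.eval (ACRealOver.of_circuit C hB hd hs)).mono (by omega) le_rfl
  have hL : ACRealOver tcBasis L (d + D + 3) ((n + 1) ^ 2 + 1) := (hLt n M).mono (by omega) le_rfl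
  have hnL : ACRealOver tcBasis (fun x => !L x) (d + D + 3) ((n + 1) ^ 2 + 1 + 1) :=
    ((hLt n M).neg not_mem_tcBasis).mono (by omega) le_rfl
  -- `C₁ = F ∧ L`, `C₂ = F ∨ ¬L`
  have h1 : ACRealOver tcBasis (fun x => decide (∀ j : Fin 2, (![F, L] : Fin 2 → (Fin n → Bool) → Bool) j x = true))
      (d + D + 3 + 1) (∑ j : Fin 2, (![s + q.eval n, (n + 1) ^ 2 + 1] : Fin 2 → ℕ) j + 1) :=
    acRealOver_forall acBasis_subset_tcBasis (fun j => by
      fin_cases j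
      · exact hF
      · exact hL)
  have h2 : ACRealOver tcBasis (fun x => decide (∃ j : Fin 2, (![F, fun x => !L x] : Fin 2 → (Fin n → Bool) → Bool) j x = true))
      (d + D + 3 + 1) (∑ j : Fin 2, (![s + q.eval n, (n + 1) ^ 2 + 1 + 1] : Fin 2 → ℕ) j + 1) :=
    acRealOver_exists acBasis_subset_tcBasis (fun j => by
      fin_cases j
      · exact hF
      · exact hnL)
  obtain ⟨C₁, hB₁, hd₁, hs₁, hc₁⟩ := h1.toCircuit
  obtain ⟨C₂, hB₂, hd₂, hs₂, hc₂⟩ := h2.toCircuit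
  refine ⟨C₁, C₂, hB₁, hB₂, by omega, by omega, ?_, ?_, fun N hN => ?_⟩
  · refine hs₁.trans ?_
    simp [Fin.sum_univ_two]; omega
  · refine hs₂.trans ?_
    simp [Fin.sum_univ_two]; omega
  · rw [hc₁, hc₂]
    have hval : ∑ j : Fin n, (Nat.testBit N (j : ℕ)).toNat * 2 ^ (j : ℕ) = N := sum_testBit_toNat hN
    have eF : F (fun i : Fin n => Nat.testBit N i) = C.eval (fun i : Fin n => Nat.testBit (N * R) i) := by
      simp only [hFdef, hval]
    have eL : L (fun i : Fin n => Nat.testBit N i) = decide (N < M) := by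
      simp only [hLdef, hval]
    have e1 : decide (∀ j : Fin 2, (![F, L] : Fin 2 → (Fin n → Bool) → Bool) j (fun i : Fin n => Nat.testBit N i) = true) =
        (F (fun i : Fin n => Nat.testBit N i) && L (fun i : Fin n => Nat.testBit N i)) := by
      simp [Fin.forall_fin_two]
    have e2 : decide (∃ j : Fin 2, (![F, fun x => !L x] : Fin 2 → (Fin n → Bool) → Bool) j (fun i : Fin n => Nat.testBit N i) = true) =
        (F (fun i : Fin n => Nat.testBit N i) || !L (fun i : Fin n => Nat.testBit N i)) := by
      simp [Fin.exists_fin_two]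
    beta_reduce
    rw [e1, e2, sgn_and_add_sgn_or, eF, eL]
    by_cases hNM : N < M <;> simp [hNM]

/-- **The tail count in reindexed form**: `Σ_{1 ≤ e ≤ 2ⁿ, D₀ < e} #{1 ≤ m ≤ (2ⁿ−1)/e²} ≤ 2ⁿ/D₀`
(from the divisor form `hTail` = `stub_sqTail` by `reindex`). -/
theorem tail_le
    (hTail : ∀ (n D₀ : ℕ), 1 ≤ D₀ →
      (∑ N ∈ range (2 ^ n), (((N.divisors.filter fun d => d * d ∣ N ∧ D₀ < d).card : ℕ) : ℝ))
        ≤ (2 : ℝ) ^ n / D₀)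
    (n D₀ : ℕ) (hD₀ : 1 ≤ D₀) :
    ∑ e ∈ Ioc 0 (2 ^ n), ∑ _m ∈ Ioc 0 ((2 ^ n - 1) / (e * e)), (if D₀ < e then (1 : ℝ) else 0)
      ≤ (2 : ℝ) ^ n / D₀ := by
  classical
  rw [← reindex n (fun e _ => if D₀ < e then (1 : ℝ) else 0)]
  refine le_trans (le_of_eq ?_) (hTail n D₀ hD₀)
  refine sum_congr rfl fun N _ => ?_
  rw [Finset.sum_ite, sum_const_zero, add_zero, sum_const, nsmul_eq_mul, mul_one, Finset.filter_filter]

/-- `|g| ≤ 1` in `ℝ`. -/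
theorem abs_cast_le_one {g : ℕ → ℤ} (hg : ∀ N, |g N| ≤ 1) (N : ℕ) : |((g N : ℤ) : ℝ)| ≤ 1 := by
  have := hg N
  rw [← Int.cast_abs]
  exact_mod_cast this

/-- **The truncated sum through the gadgets.** If the correlations of `g` with the two gadget circuits
are `≤ B` in absolute value, then `|Σ_{1 ≤ m ≤ M} g(m) F(m)| ≤ B + 1` where `F(m) = sgn C(bits(m R))`
and `M + 1 ≤ 2ⁿ` (the gadget identity holds for `m < 2ⁿ`; the term `m = 0` costs `1`). -/
theorem trunc_le {n : ℕ} {g : ℕ → ℤ} (hg : ∀ N, |g N| ≤ 1) (C C₁ C₂ : Circuit (Fin n)) (R M : ℕ)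
    (hM : M + 1 ≤ 2 ^ n)
    (hgad : ∀ N : ℕ, N < 2 ^ n →
      sgn (C₁.eval fun i : Fin n => Nat.testBit N i) + sgn (C₂.eval fun i : Fin n => Nat.testBit N i) =
        if N < M + 1 then 2 * sgn (C.eval fun i : Fin n => Nat.testBit (N * R) i) else 0)
    {B : ℝ}
    (h₁ : |∑ N ∈ range (2 ^ n), ((g N : ℤ) : ℝ) * sgn (C₁.eval fun i : Fin n => Nat.testBit N i)| ≤ B)
    (h₂ : |∑ N ∈ range (2 ^ n), ((g N : ℤ) : ℝ) * sgn (C₂.eval fun i : Fin n => Nat.testBit N i)| ≤ B) :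
    |∑ m ∈ Ioc 0 M, ((g m : ℤ) : ℝ) * sgn (C.eval fun i : Fin n => Nat.testBit (m * R) i)| ≤ B + 1 := by
  -- the sum of the two correlations is twice the truncated sum over `range (M+1)`
  have hsum : ∑ N ∈ range (2 ^ n), ((g N : ℤ) : ℝ) * sgn (C₁.eval fun i : Fin n => Nat.testBit N i) +
      ∑ N ∈ range (2 ^ n), ((g N : ℤ) : ℝ) * sgn (C₂.eval fun i : Fin n => Nat.testBit N i) =
      2 * ∑ m ∈ range (M + 1), ((g m : ℤ) : ℝ) * sgn (C.eval fun i : Fin n => Nat.testBit (m * R) i) := by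
    rw [← sum_add_distrib]
    have hsub : range (M + 1) = (range (2 ^ n)).filter (fun N => N < M + 1) := by
      ext N; simp only [mem_range, mem_filter]; omega
    rw [hsub, sum_filter, mul_sum]
    refine sum_congr rfl fun N hN => ?_
    rw [← mul_add, hgad N (mem_range.1 hN)]
    split_ifs <;> ring
  -- peel off `m = 0`
  have hpeel : ∑ m ∈ range (M + 1), ((g m : ℤ) : ℝ) * sgn (C.eval fun i : Fin n => Nat.testBit (m * R) i) =
      ((g 0 : ℤ) : ℝ) * sgn (C.eval fun i : Fin n => Nat.testBit (0 * R) i) +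
        ∑ m ∈ Ioc 0 M, ((g m : ℤ) : ℝ) * sgn (C.eval fun i : Fin n => Nat.testBit (m * R) i) := by
    rw [Finset.range_eq_Ico, Finset.sum_eq_sum_Ico_succ_bot (Nat.succ_pos M)]
    congr 1
  have h0 : |((g 0 : ℤ) : ℝ) * sgn (C.eval fun i : Fin n => Nat.testBit (0 * R) i)| ≤ 1 := by
    have hs1 : ∀ b : Bool, |sgn b| = 1 := fun b => by cases b <;> simp [sgn]
    rw [abs_mul, hs1, mul_one]; exact abs_cast_le_one hg 0
  have key : 2 * ∑ m ∈ Ioc 0 M, ((g m : ℤ) : ℝ) * sgn (C.eval fun i : Fin n => Nat.testBit (m * R) i) =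
      (∑ N ∈ range (2 ^ n), ((g N : ℤ) : ℝ) * sgn (C₁.eval fun i : Fin n => Nat.testBit N i) +
        ∑ N ∈ range (2 ^ n), ((g N : ℤ) : ℝ) * sgn (C₂.eval fun i : Fin n => Nat.testBit N i)) -
      2 * (((g 0 : ℤ) : ℝ) * sgn (C.eval fun i : Fin n => Nat.testBit (0 * R) i)) := by
    rw [hsum, hpeel]; ring
  have habs : 2 * |∑ m ∈ Ioc 0 M, ((g m : ℤ) : ℝ) * sgn (C.eval fun i : Fin n => Nat.testBit (m * R) i)| ≤
      (B + B) + 2 * 1 := by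
    rw [show (2 : ℝ) * |∑ m ∈ Ioc 0 M, ((g m : ℤ) : ℝ) * sgn (C.eval fun i : Fin n => Nat.testBit (m * R) i)| =
      |2 * ∑ m ∈ Ioc 0 M, ((g m : ℤ) : ℝ) * sgn (C.eval fun i : Fin n => Nat.testBit (m * R) i)| by
      rw [abs_mul, abs_two], key]
    refine (abs_sub _ _).trans (add_le_add ((abs_add_le _ _).trans (add_le_add h₁ h₂)) ?_)
    rw [abs_mul, abs_two]; linarith
  linarith

/-- Eventually `D₀ ≤ (ε/4)·2ⁿ` and `D₀ ≤ 2ⁿ`. -/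
theorem eventually_large (D₀ : ℕ) {ε : ℝ} (hε : 0 < ε) :
    ∀ᶠ n : ℕ in atTop, (D₀ : ℝ) ≤ ε / 4 * (2 : ℝ) ^ n ∧ D₀ ≤ 2 ^ n := by
  have h2 : Tendsto (fun n : ℕ => (2 : ℝ) ^ n) atTop atTop := tendsto_pow_atTop_atTop_of_one_lt one_lt_two
  have hA : ∀ᶠ n : ℕ in atTop, (D₀ : ℝ) * (4 / ε) ≤ (2 : ℝ) ^ n := h2.eventually_ge_atTop _
  have hB : ∀ᶠ n : ℕ in atTop, (D₀ : ℝ) ≤ (2 : ℝ) ^ n := h2.eventually_ge_atTop _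
  filter_upwards [hA, hB] with n hA hB
  constructor
  · have h4 : 0 < 4 / ε := by positivity
    calc (D₀ : ℝ) = (D₀ : ℝ) * (4 / ε) * (ε / 4) := by field_simp
      _ ≤ (2 : ℝ) ^ n * (ε / 4) := mul_le_mul_of_nonneg_right hA (by positivity)
      _ = ε / 4 * (2 : ℝ) ^ n := mul_comm _ _
  · exact_mod_cast hB

/-- **The transfer (abstract form).** From the comparison gadget `hLt` (`stub_decideLt`), the tail
count `hTail` (`stub_sqTail`) and the dilation closure (`stub_dilate`): `TC⁰`-orthogonality of a bounded
`g` passes to `N ↦ Σ_{e² ∣ N} h(e) g(N/e²)` for every bounded `h`. -/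
theorem main
    (hLt : ∀ (n X : ℕ), ACRealOver tcBasis
      (fun x : Fin n → Bool => decide (∑ i : Fin n, (x i).toNat * 2 ^ (i : ℕ) < X)) 3 ((n + 1) ^ 2 + 1))
    (hTail : ∀ (n D₀ : ℕ), 1 ≤ D₀ →
      (∑ N ∈ range (2 ^ n), (((N.divisors.filter fun d => d * d ∣ N ∧ D₀ < d).card : ℕ) : ℝ))
        ≤ (2 : ℝ) ^ n / D₀)
    (g h : ℕ → ℤ) (hg : ∀ N, |g N| ≤ 1) (hh : ∀ d, |h d| ≤ 1)
    (hP : ∀ (d : ℕ) (p : Polynomial ℕ) (ε : ℝ), 0 < ε → ∀ᶠ n : ℕ in atTop, ∀ C : Circuit (Fin n),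
      C.IsOver tcBasis → C.acDepth ≤ d → C.size ≤ p.eval n →
        |∑ N ∈ range (2 ^ n), ((g N : ℤ) : ℝ) * sgn (C.eval (fun i : Fin n => Nat.testBit N i))|
          ≤ ε * (2 : ℝ) ^ n) :
    ∀ (d : ℕ) (p : Polynomial ℕ) (ε : ℝ), 0 < ε → ∀ᶠ n : ℕ in atTop, ∀ C : Circuit (Fin n),
      C.IsOver tcBasis → C.acDepth ≤ d → C.size ≤ p.eval n →
        |∑ N ∈ range (2 ^ n),
            ((∑ e ∈ N.divisors.filter (fun e => e * e ∣ N), h e * g (N / (e * e)) : ℤ) : ℝ) *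
              sgn (C.eval (fun i : Fin n => Nat.testBit N i))| ≤ ε * (2 : ℝ) ^ n := by
  classical
  obtain ⟨D, q, hdil⟩ := stub_dilate
  intro d p ε hε
  -- parameters: `D₀ ≥ 4/ε`, `ε' = ε/(4 D₀)`, the enlarged depth and size polynomial
  obtain ⟨D₀, hD₀1, hD₀ε⟩ : ∃ D₀ : ℕ, 1 ≤ D₀ ∧ 4 / ε ≤ (D₀ : ℝ) :=
    ⟨⌈4 / ε⌉₊ + 1, by omega, (Nat.le_ceil _).trans (by push_cast; linarith)⟩
  have hD₀pos : (0 : ℝ) < D₀ := by exact_mod_cast hD₀1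
  set ε' : ℝ := ε / (4 * D₀) with hε'
  have hε'0 : 0 < ε' := by positivity
  have hPn := hP (d + D + 4) (p + q + (Polynomial.X + 1) ^ 2 + 3) ε' hε'0
  filter_upwards [hPn, eventually_large D₀ hε] with n hn hlarge C hB hd hs
  obtain ⟨hnD, hnD'⟩ := hlarge
  set F : ℕ → ℝ := fun N => sgn (C.eval fun i : Fin n => Nat.testBit N i) with hFdef
  -- Step A: reindex `N = e² m`
  have hre : ∑ N ∈ range (2 ^ n),
      ((∑ e ∈ N.divisors.filter (fun e => e * e ∣ N), h e * g (N / (e * e)) : ℤ) : ℝ) * F N =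
      ∑ e ∈ Ioc 0 (2 ^ n), (h e : ℝ) *
        ∑ m ∈ Ioc 0 ((2 ^ n - 1) / (e * e)), ((g m : ℤ) : ℝ) * F (e * e * m) := by
    have e1 : ∀ N ∈ range (2 ^ n),
        ((∑ e ∈ N.divisors.filter (fun e => e * e ∣ N), h e * g (N / (e * e)) : ℤ) : ℝ) * F N =
        ∑ e ∈ N.divisors.filter (fun e => e * e ∣ N), (h e : ℝ) * g (N / (e * e)) * F N := by
      intro N _; push_cast; rw [sum_mul]
    rw [sum_congr rfl e1, reindex n (fun e N => (h e : ℝ) * g (N / (e * e)) * F N)]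
    refine sum_congr rfl fun e he => ?_
    rw [mul_sum]
    refine sum_congr rfl fun m _ => ?_
    have hee : 0 < e * e := Nat.mul_pos (mem_Ioc.1 he).1 (mem_Ioc.1 he).1
    rw [Nat.mul_div_cancel_left _ hee]; ring
  rw [hre]
  -- Step C: the truncated sums for every `e`
  have hT : ∀ e ∈ Ioc 0 (2 ^ n),
      |∑ m ∈ Ioc 0 ((2 ^ n - 1) / (e * e)), ((g m : ℤ) : ℝ) * F (e * e * m)| ≤ ε' * 2 ^ n + 1 := by
    intro e he
    have he0 : 0 < e := (mem_Ioc.1 he).1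
    set Me : ℕ := (2 ^ n - 1) / (e * e) with hMe
    have hMe2 : Me + 1 ≤ 2 ^ n := by
      have h1 : Me ≤ 2 ^ n - 1 := Nat.div_le_self _ _
      have h2 : 0 < 2 ^ n := Nat.two_pow_pos n
      omega
    obtain ⟨C₁, C₂, hB₁, hB₂, hd₁, hd₂, hs₁, hs₂, hgad⟩ :=
      exists_gadgets hdil hLt C hB hd hs (e * e) (Me + 1)
    have hsz : ∀ C' : Circuit (Fin n), C'.size ≤ p.eval n + q.eval n + (n + 1) ^ 2 + 3 →
        C'.size ≤ (p + q + (Polynomial.X + 1) ^ 2 + 3).eval n := by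
      intro C' h'
      simpa [Polynomial.eval_add, Polynomial.eval_mul, Polynomial.eval_pow, Polynomial.eval_X] using h'
    have hU₁ := hn C₁ hB₁ hd₁ (hsz C₁ hs₁)
    have hU₂ := hn C₂ hB₂ hd₂ (hsz C₂ hs₂)
    have ht := trunc_le hg C C₁ C₂ (e * e) Me hMe2 hgad hU₁ hU₂
    -- align `m * (e*e)` with `e * e * m`
    refine le_trans (le_of_eq ?_) ht
    congr 1
    refine sum_congr rfl fun m _ => ?_
    rw [hFdef, mul_comm m (e * e)]
  -- Step B/D: split `e ≤ D₀` / `e > D₀` and add up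
  rw [← Finset.sum_Ioc_consecutive _ (Nat.zero_le D₀) hnD']
  have hsmall : |∑ e ∈ Ioc 0 D₀, (h e : ℝ) *
      ∑ m ∈ Ioc 0 ((2 ^ n - 1) / (e * e)), ((g m : ℤ) : ℝ) * F (e * e * m)| ≤ D₀ * (ε' * 2 ^ n + 1) := by
    refine (abs_sum_le_sum_abs _ _).trans ?_
    have hcard : ((Ioc 0 D₀).card : ℝ) = D₀ := by simp
    rw [← hcard, ← nsmul_eq_mul, ← sum_const]
    refine sum_le_sum fun e he => ?_
    have he' : e ∈ Ioc 0 (2 ^ n) := by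
      rw [mem_Ioc] at he ⊢; exact ⟨he.1, he.2.trans hnD'⟩
    rw [abs_mul]
    calc |(h e : ℝ)| * |∑ m ∈ Ioc 0 ((2 ^ n - 1) / (e * e)), ((g m : ℤ) : ℝ) * F (e * e * m)|
        ≤ 1 * (ε' * 2 ^ n + 1) :=
          mul_le_mul (abs_cast_le_one hh e) (hT e he') (abs_nonneg _) zero_le_one
      _ = ε' * 2 ^ n + 1 := one_mul _
  have htail : |∑ e ∈ Ioc D₀ (2 ^ n), (h e : ℝ) *
      ∑ m ∈ Ioc 0 ((2 ^ n - 1) / (e * e)), ((g m : ℤ) : ℝ) * F (e * e * m)| ≤ (2 : ℝ) ^ n / D₀ := by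
    refine (abs_sum_le_sum_abs _ _).trans ?_
    refine le_trans ?_ (tail_le hTail n D₀ hD₀1)
    rw [← Finset.sum_Ioc_consecutive _ (Nat.zero_le D₀) hnD']
    have hzero : ∑ e ∈ Ioc 0 D₀, ∑ _m ∈ Ioc 0 ((2 ^ n - 1) / (e * e)), (if D₀ < e then (1 : ℝ) else 0) = 0 := by
      refine sum_eq_zero fun e he => ?_
      rw [mem_Ioc] at he
      simp [show ¬ D₀ < e by omega]
    rw [hzero, zero_add]
    refine sum_le_sum fun e he => ?_
    rw [mem_Ioc] at he
    rw [abs_mul]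
    calc |(h e : ℝ)| * |∑ m ∈ Ioc 0 ((2 ^ n - 1) / (e * e)), ((g m : ℤ) : ℝ) * F (e * e * m)|
        ≤ 1 * ∑ m ∈ Ioc 0 ((2 ^ n - 1) / (e * e)), |((g m : ℤ) : ℝ) * F (e * e * m)| :=
          mul_le_mul (abs_cast_le_one hh e) (abs_sum_le_sum_abs _ _) (abs_nonneg _) zero_le_one
      _ ≤ ∑ _m ∈ Ioc 0 ((2 ^ n - 1) / (e * e)), (if D₀ < e then (1 : ℝ) else 0) := by
          rw [one_mul]
          refine sum_le_sum fun m _ => ?_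
          have hs1 : ∀ b : Bool, |sgn b| = 1 := fun b => by cases b <;> simp [sgn]
          rw [if_pos he.1, abs_mul, hFdef, hs1, mul_one]
          exact abs_cast_le_one hg m
  -- the budget: `D₀ ε' 2ⁿ = ε 2ⁿ/4`, `D₀ ≤ ε 2ⁿ/4`, `2ⁿ/D₀ ≤ ε 2ⁿ/4`
  have hb1 : (D₀ : ℝ) * (ε' * 2 ^ n) = ε / 4 * 2 ^ n := by
    rw [hε']; field_simp
  have hb3 : (2 : ℝ) ^ n / D₀ ≤ ε / 4 * 2 ^ n := by
    rw [div_le_iff₀ hD₀pos]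
    have : (2 : ℝ) ^ n * 4 ≤ (2 : ℝ) ^ n * (ε * D₀) := by
      refine mul_le_mul_of_nonneg_left ?_ (by positivity)
      rw [div_le_iff₀ hε] at hD₀ε; linarith
    nlinarith
  calc |∑ e ∈ Ioc 0 D₀, (h e : ℝ) * ∑ m ∈ Ioc 0 ((2 ^ n - 1) / (e * e)), ((g m : ℤ) : ℝ) * F (e * e * m) +
        ∑ e ∈ Ioc D₀ (2 ^ n), (h e : ℝ) * ∑ m ∈ Ioc 0 ((2 ^ n - 1) / (e * e)), ((g m : ℤ) : ℝ) * F (e * e * m)|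
      ≤ D₀ * (ε' * 2 ^ n + 1) + (2 : ℝ) ^ n / D₀ := (abs_add_le _ _).trans (add_le_add hsmall htail)
    _ = ε / 4 * 2 ^ n + D₀ + (2 : ℝ) ^ n / D₀ := by rw [mul_add, hb1, mul_one]
    _ ≤ ε / 4 * 2 ^ n + ε / 4 * 2 ^ n + ε / 4 * 2 ^ n := by linarith
    _ ≤ ε * 2 ^ n := by nlinarith [pow_pos (two_pos : (0:ℝ) < 2) n]

end SqTransfer

/-- **Stub `stub_sqTransfer` (line `Sketch`, v8.1, lead)** — `TC⁰`-orthogonality of a bounded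
sequence `g` of the binary digits passes to `N ↦ Σ_{e² ∣ N} h(e) g(N/e²)` for every bounded `h`
(`SqTransfer.main` with the landed `stub_decideLt` and `stub_sqTail`, and `stub_dilate`). -/
theorem stub_sqTransfer (g h : ℕ → ℤ) (hg : ∀ N, |g N| ≤ 1) (hh : ∀ d, |h d| ≤ 1) (hP : ∀ (d : ℕ) (p : Polynomial ℕ) (ε : ℝ), 0 < ε → ∀ᶠ n : ℕ in atTop, ∀ C : Circuit (Fin n), C.IsOver tcBasis → C.acDepth ≤ d → C.size ≤ p.eval n → |∑ N ∈ Finset.range (2 ^ n), ((g N : ℤ) : ℝ) * sgn (C.eval (fun i : Fin n => Nat.testBit N i))| ≤ ε * (2 : ℝ) ^ n) : ∀ (d : ℕ) (p : Polynomial ℕ) (ε : ℝ), 0 < ε → ∀ᶠ n : ℕ in atTop, ∀ C : Circuit (Fin n), C.IsOver tcBasis → C.acDepth ≤ d → C.size ≤ p.eval n → |∑ N ∈ Finset.range (2 ^ n), ((∑ e ∈ N.divisors.filter (fun e => e * e ∣ N), h e * g (N / (e * e)) : ℤ) : ℝ) * sgn (C.eval (fun i : Fin n => Nat.testBit N i))|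 ≤ ε * (2 : ℝ) ^ n :=
  SqTransfer.main (fun n X => stub_decideLt acBasis_subset_tcBasis n X) stub_sqTail g h hg hh hP

end Summit.QuantumAdvantage.QuantumAdvantage.Theorems.LiouvilleOrthogonalTC0
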